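import Literature.AlgebraicGeometry.Resolution.InseparableLocalUniformizationAbhyankarProofs
import Literature.AlgebraicGeometry.Resolution.AbhyankarResidueSeparability
import Literature.AlgebraicGeometry.Resolution.AbhyankarToroidalChartsInertial
import Literature.AlgebraicGeometry.Resolution.ToricChartNormal
import Literature.AlgebraicGeometry.Resolution.GeneralizedStabilityHolds
import HarnessLib

/-!
# Descent inseparable local uniformization of Abhyankar valuations: trust base and discharge of `Temkin2013DescentAbhyankar`

Topic: `Literature/AlgebraicGeometry/Resolution`. M. Temkin, *Inseparable local uniformization*,
J. Algebra 373 (2013) 65–119 = arXiv:0804.1554v3 (numbers and pages of this version), proof of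
Thm. 4.1.1, Step 0 (p. 47: the Abhyankar case `D_{K/k} = 0` of the induction on the defect rank
is Thm. 5.5.2 (i) for `n = 1`), vendored as the named fact `Temkin2013DescentAbhyankar`
(`InseparableLocalUniformizationDefect.lean`).

This leaf file only ASSEMBLES theorems of the tree: it records on what the discharge
`Temkin2013DescentAbhyankar_holds` rests, and performs it. In the tree:

* `Temkin2013DescentAbhyankar.of_section5 : Temkin2013_Thm553 → Temkin2013_Thm551iii →
  Temkin2013DescentAbhyankar` (`InseparableLocalUniformizationAbhyankarProofs.lean`; the printed
  proof of Thm. 5.5.2 (i), pp. 60–61, with Prop. 5.4.3, Cor. 5.4.2 and Thm. A.2.1 proved);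
* Thm. 5.5.3 from the generalized stability theorem: `Temkin2013_Thm553.of_stability`
  (`AbhyankarResidueSeparability.lean`);
* Thm. 5.5.1 (iii) from the generalized stability theorem: `Temkin2013_Thm551iii.of_inertial`
  (`ToricChartNormal.lean`, Hochster's normality of toric charts proved there) composed with
  `Temkin2013_Thm551iii_inertial.of_stability` (`AbhyankarToroidalChartsInertial.lean`);
* the generalized stability theorem over a trivially valued ground field is itself reduced in
  the tree to the three normal forms of Kuhlmann 2010, §4 (Props. 4.6, 4.12, 4.13:
  `Kuhlmann2010Stability.of_leaves`, `GeneralizedStabilityTrustBase.lean`), and DISCHARGED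
  (`Kuhlmann2010Stability_holds`, `GeneralizedStabilityHolds.lean`: the three normal forms proved,
  Prop. 4.13 through a graded Frobenius-closed basis of the residue function field, [K5] Thm. 10).

Hence (PROVED here):

* `Temkin2013DescentAbhyankar.of_stability : Kuhlmann2010Stability → Temkin2013DescentAbhyankar` —
  the Abhyankar base of Thm. 4.1.1 rests on ONE external theorem, F.-V. Kuhlmann's generalized
  stability theorem (Temkin 2013, Remark 2.1.3; Kuhlmann 2010, Thm. 1.1), every other printed
  ingredient of Temkin 2013, §§4.1, 5.3–5.5 and App. A on the way being a theorem of the tree;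
* `Temkin2013DescentAbhyankar_holds` — **DISCHARGE** of `Temkin2013DescentAbhyankar`: the term
  `Temkin2013DescentAbhyankar.of_stability Kuhlmann2010Stability_holds`. (The same statement also
  follows from the discharge `Temkin2013Abhyankar_holds` of Thm. 5.5.2 (i), `n = 1`
  (`InseparableLocalUniformizationAbhyankarHolds.lean`) through
  `Temkin2013Abhyankar.descentAbhyankar`; the term here goes through the `D = 0`, height `≤ 1`,
  normal-model assembly `Temkin2013DescentAbhyankar.of_section5` directly.)

## Sources

* M. Temkin, *Inseparable local uniformization*, arXiv:0804.1554v3: proof of Thm. 4.1.1, Step 0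
  (p. 47), Thm. 5.5.1 (iii), Thm. 5.5.2 (i) and its proof, Thm. 5.5.3 (pp. 59–61), Remark 2.1.3
  (p. 10). [Temkin2013]
* F.-V. Kuhlmann, *Elimination of ramification I: The generalized stability theorem*, Trans.
  Amer. Math. Soc. 362 (2010) 5697–5727 = arXiv:1003.5678: Thm. 1.1, Props. 4.6, 4.12, 4.13.
  [Kuhlmann2010]
-/

namespace Literature.AlgebraicGeometry.Resolution

universe u

/-- **The Abhyankar base of Temkin 2013, Thm. 4.1.1 (`Temkin2013DescentAbhyankar`) from the
generalized stability theorem alone**: Thm. 5.5.3 (`Temkin2013_Thm553.of_stability`) and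
Thm. 5.5.1 (iii) (`Temkin2013_Thm551iii.of_inertial ∘ Temkin2013_Thm551iii_inertial.of_stability`)
both follow from `Kuhlmann2010Stability` in the tree, and the Abhyankar base is assembled from them
along the printed proof of Thm. 5.5.2 (i) (`Temkin2013DescentAbhyankar.of_section5`). PROVED.
[cite: Temkin2013, proof of Thm. 4.1.1, Step 0 (p. 47) and Thm. 5.5.2 (i) (p. 60 of arXiv:0804.1554v3)]
[cite: Kuhlmann2010, Thm. 1.1] -/
theorem Temkin2013DescentAbhyankar.of_stability (hS : Kuhlmann2010Stability.{u}) :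
    Temkin2013DescentAbhyankar.{u} :=
  Temkin2013DescentAbhyankar.of_section5 (Temkin2013_Thm553.of_stability hS)
    (Temkin2013_Thm551iii.of_inertial (Temkin2013_Thm551iii_inertial.of_stability hS))

/-- **Temkin 2013, proof of Thm. 4.1.1, Step 0 — the Abhyankar base `D_{K/k} = 0`
(`Temkin2013DescentAbhyankar`), discharged**: for a finitely generated `K/k` with `char k = p > 0`,
an Abhyankar `k`-valuation ring of `K` of height `≤ 1` and a normal affine `k`-model, after a
finite purely inseparable extension `l/k` of the ground field there is an affine `l`-model of the
extended valuation ring of `lK`, refining the normalized base change, which is `l`-smooth at the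
centre with residue field formally smooth over `l` (Thm. 5.5.2 (i) for `n = 1`). The term is
`Temkin2013DescentAbhyankar.of_stability` (§5 of the source — Thm. 5.5.3, Thm. 5.5.1 (iii),
Prop. 5.4.3, Cor. 5.4.2, Thm. A.2.1 — proved in the tree) applied to the discharge
`Kuhlmann2010Stability_holds` of F.-V. Kuhlmann's generalized stability theorem over a trivially
valued ground field (the one external input of §5, Remark 2.1.3 of the source). PROVED.
[cite: Temkin2013, proof of Thm. 4.1.1, Step 0 (p. 47) and Thm. 5.5.2 (i) (p. 60 of arXiv:0804.1554v3; = Thm. 5.2.5 of arXiv v1)]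
[cite: Kuhlmann2010, Thm. 1.1] -/
theorem Temkin2013DescentAbhyankar_holds : Temkin2013DescentAbhyankar.{u} :=
  Temkin2013DescentAbhyankar.of_stability Kuhlmann2010Stability_holds

end Literature.AlgebraicGeometry.Resolution
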